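import Mathlib
import Literature.Topology.FourManifolds.SeifertAlgebraicModelsWeierstrass
import HarnessLib

/-!
# Polynomials are dense in `𝒞^k(Ω)` (Trèves 1967, Ch. 15, Corollary 4 of Theorem 15.3)

Topic `Literature/Analysis/Approximation`.

F. Trèves, *Topological Vector Spaces, Distributions and Kernels* (Academic Press, 1967),
Chapter 15 ("Approximation procedures in spaces of functions"). `𝒞^k(Ω)`, `Ω ⊆ ℝⁿ` open,
`0 ≤ k ≤ +∞`, carries the topology of uniform convergence of the derivatives of order `≤ k` on
the compact subsets of `Ω` (Ch. 10, Example I). **Corollary 4 of Theorem 15.3:** "The polynomials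
form a dense linear subspace of `𝒞^k(Ω)` (`0 ≤ k ≤ +∞`)." (Proof there: `𝒞_c^∞(Ω)` is dense in
`𝒞^k(Ω)` — Thm. 15.3, Cor. 1 — and every `𝒞_c^∞` function is the limit in `𝒞^∞(ℝⁿ)` of the
Taylor polynomials of its Gauss–Weierstrass regularisations, Lemma 15.1, Cor. 2.)

Vendored for FINITE `k` in seminorm form: for `f ∈ 𝒞^k(Ω)`, a compact `K ⊆ Ω` and `ε > 0` there
is a real polynomial `P` in `n` variables with `‖D^i(P - f)(x)‖ ≤ ε` for all `x ∈ K` and all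
`i ≤ k` (the `i`-th Fréchet derivative `iteratedFDeriv`; at points of the open set `Ω` it is the
classical derivative, and the operator norms of `D^i` dominate / are dominated by the partial
derivatives `∂^α`, `|α| = i`, up to combinatorial constants, so this is exactly convergence in
`𝒞^k(Ω)`). Mathlib has the `k = 0` case (Stone–Weierstrass,
`polynomialFunctions.topologicalClosure`; Bernstein `bernsteinApproximation_uniform` in one
variable) and nothing for `k ≥ 1` (`lean search 'Nachbin|dense.*contDiff.*polynomial'`: no hits).

Use in the tree: `k = 1` upgrades generator identities tested against polynomial cylindrical
functionals to all compactly supported `𝒞¹` cylindrical test functionals on a bounded support —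
`Summit.AnomalousDissipation.AnomalousDissipation.Theses.MomentParity.MomentClosure`.
A DEFINITION of the statement (named fact, review-queued), no proof; users take
`(h : Treves1967_ch15_cor4)`.

## Discharge (appended): `Treves1967_ch15_cor4_holds`

The fact is PROVED below (`theorem Treves1967_ch15_cor4_holds : Treves1967_ch15_cor4`), following
the architecture of Trèves' Ch. 15 with one substitution. Trèves: (Lemma 15.1, p. 144) the
regularisations `ρ ⋆ f` of a compactly supported continuous `f` by an approximate identity converge
to `f` uniformly; (Cor. 1, p. 145) by Leibniz' rule `∂ᵖ(ρ ⋆ f) = ρ ⋆ ∂ᵖf`, so the same holds in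
`𝒞^m` for `f ∈ 𝒞_c^m`; (Cor. 2) with the Gauss kernel the regularisations are entire, hence
(Thm. 15.1, Taylor truncation) limits of polynomials in `𝒞^∞`; (Thm. 15.3 / Cor. 4, pp. 148–149) a
`𝒞^k` function on `Ω` is cut off to `h f ∈ 𝒞_c^k`, `h f = f` near any given compact `K ⊆ Ω`.
Here the Gauss kernel + Taylor step is replaced (Trèves, p. 144: "any other sequence with similar
properties could have been used") by a POLYNOMIAL kernel `k` uniformly close, on the ball that
matters, to a smooth normed bump `ψ` (multivariate Weierstrass, from Mathlib's Stone–Weierstrass):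
`k ⋆ f` is then itself a polynomial (`exists_mvPolynomial_convolution_eval_eq`, after
`Literature.Topology.FourManifolds.exists_eval_sub_eq_sum`), and
`‖Dⁱ(k ⋆ f) − Dⁱ(ψ ⋆ f)‖ ≤ η ∫‖Dⁱf‖` on `K`. The analytic engine
(`exists_forall_norm_iteratedFDeriv_convolution_sub_self_le`, induction on the order moving one
derivative onto `f` at a time, for Banach-valued `f` on any finite-dimensional `E` with an additive
Haar measure) is stated kernel-family-agnostically
(`exists_mem_forall_norm_iteratedFDeriv_convolution_sub_self_le`) so that it also serves the
`EuclideanSpace` rendering `Treves1967_polynomialsDense_Cm` (`PolynomialDensityCm.lean`). The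
order-one Euclidean case of this road is `Literature.Topology.FourManifolds.exists_mvPolynomial_close_C1`
(Akbulut–King, Lemma 2.8.1 (a)), whose `𝒞⁰` Weierstrass and kernel-expansion lemmas are reused.
-/

namespace Literature.Analysis.Approximation

/-- **Trèves 1967, Ch. 15, Corollary 4 of Theorem 15.3** (polynomials are dense in `𝒞^k(Ω)`),
finite `k`, seminorm form: if `Ω ⊆ ℝⁿ` is open, `f : ℝⁿ → ℝ` is `𝒞^k` on `Ω`, `K ⊆ Ω` is compact
and `ε > 0`, then some polynomial `P ∈ ℝ[x₁, …, xₙ]` satisfies `‖D^i(P - f)(x)‖ ≤ ε` for every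
`x ∈ K` and every order `i ≤ k`. Grounds the test-class upgrade (polynomial ⇒ `𝒞¹_c` cylindrical
tests, `k = 1`) in `Summit.AnomalousDissipation.AnomalousDissipation.Theses.MomentParity.MomentClosure`.
[cite: Treves1967, Ch. 15, Cor. 4 of Thm. 15.3] -/
def Treves1967_ch15_cor4 : Prop :=
  ∀ (n k : ℕ) (Ω : Set (Fin n → ℝ)), IsOpen Ω →
    ∀ f : (Fin n → ℝ) → ℝ, ContDiffOn ℝ k f Ω →
      ∀ K : Set (Fin n → ℝ), IsCompact K → K ⊆ Ω →
        ∀ ε : ℝ, 0 < ε →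
          ∃ P : MvPolynomial (Fin n) ℝ, ∀ i : ℕ, i ≤ k → ∀ x ∈ K,
            ‖iteratedFDeriv ℝ i (fun y => MvPolynomial.eval y P - f y) x‖ ≤ ε

end Literature.Analysis.Approximation

/-! ## Proofs (Trèves 1967, Ch. 15: Lemma 15.1, Cor. 1–2; Thm. 15.3, Cor. 4) -/

open scoped ContDiff Topology Convolution Manifold
open Function Set MeasureTheory ContinuousLinearMap Metric

noncomputable section

namespace Literature.Analysis.Approximation

universe u v

section Engine

variable {E : Type u} [NormedAddCommGroup E] [NormedSpace ℝ E] [FiniteDimensional ℝ E]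
  [MeasurableSpace E] [BorelSpace E] {μ : Measure E} [μ.IsAddHaarMeasure]

omit [FiniteDimensional ℝ E] [MeasurableSpace E] [BorelSpace E] in
/-- `(lsmul ℝ ℝ).precompR E = lsmul ℝ ℝ` on `E →L[ℝ] F'`-valued functions: the bilinear map
appearing in `HasCompactSupport.hasFDerivAt_convolution_right` for `L = lsmul ℝ ℝ` is again
scalar multiplication. [folklore] -/
theorem precompR_lsmul (F' : Type*) [NormedAddCommGroup F'] [NormedSpace ℝ F'] :
    ((lsmul ℝ ℝ).precompR E : ℝ →L[ℝ] (E →L[ℝ] F') →L[ℝ] (E →L[ℝ] F')) = lsmul ℝ ℝ := by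
  ext c A
  simp

/-- **Leibniz' rule for the regularisation** (Trèves 1967, proof of Cor. 1 of Lemma 15.1,
p. 145: "we can differentiate under the integral sign"): for a continuous kernel `k` and a
compactly supported `𝒞¹` function `f`, `D(k ⋆ f - f) = k ⋆ Df - Df`. [folklore] -/
theorem fderiv_convolution_sub_self {F' : Type*} [NormedAddCommGroup F'] [NormedSpace ℝ F']
    {k : E → ℝ} (hk : Continuous k) {f : E → F'} (hf : ContDiff ℝ 1 f)
    (hfc : HasCompactSupport f) :
    fderiv ℝ (k ⋆[lsmul ℝ ℝ, μ] f - f) = k ⋆[lsmul ℝ ℝ, μ] fderiv ℝ f - fderiv ℝ f := by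
  funext x
  have h1 := hfc.hasFDerivAt_convolution_right (lsmul ℝ ℝ) (hk.locallyIntegrable (μ := μ)) hf x
  rw [precompR_lsmul] at h1
  exact (h1.sub ((hf.differentiable one_ne_zero) x).hasFDerivAt).fderiv

/-- **Changing the kernel where it matters** (general finite-dimensional `E`). If the real
kernels `k₁, k₂` differ by at most `η` at every `t` with `x - t` in a set `T ⊇ supp g`
(`g` continuous with compact support), then `‖(k₁ ⋆ g)(x) - (k₂ ⋆ g)(x)‖ ≤ η ∫ ‖g‖`. [folklore] -/
theorem dist_convolution_le_of_abs_sub_kernel_le {F' : Type*} [NormedAddCommGroup F']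
    [NormedSpace ℝ F'] [CompleteSpace F'] {k₁ k₂ : E → ℝ} (hk₁ : Continuous k₁)
    (hk₂ : Continuous k₂) {g : E → F'} (hg : Continuous g) (hgc : HasCompactSupport g)
    {T : Set E} (hT : support g ⊆ T) {x : E} {η : ℝ} (hker : ∀ t, x - t ∈ T → |k₁ t - k₂ t| ≤ η) :
    dist ((k₁ ⋆[lsmul ℝ ℝ, μ] g) x) ((k₂ ⋆[lsmul ℝ ℝ, μ] g) x) ≤ η * ∫ t, ‖g t‖ ∂μ := by
  have hgx : Continuous fun t : E => g (x - t) := hg.comp (continuous_const.sub continuous_id)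
  have hgxc : HasCompactSupport fun t : E => g (x - t) :=
    hgc.comp_homeomorph (Homeomorph.subLeft x)
  have hint : ∀ {k : E → ℝ}, Continuous k →
      Integrable (fun t => lsmul ℝ ℝ (k t) (g (x - t))) μ := by
    intro k hk
    have : (fun t => lsmul ℝ ℝ (k t) (g (x - t))) = k • fun t => g (x - t) := by
      ext t; simp
    rw [this]
    exact (hk.smul hgx).integrable_of_hasCompactSupport hgxc.smul_left
  rw [dist_eq_norm, convolution_def, convolution_def, ← integral_sub (hint hk₁) (hint hk₂)]
  calc ‖∫ t, (lsmul ℝ ℝ (k₁ t) (g (x - t)) - lsmul ℝ ℝ (k₂ t) (g (x - t))) ∂μ‖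
      ≤ ∫ t, η * ‖g (x - t)‖ ∂μ := by
        refine norm_integral_le_of_norm_le ((hgx.norm.const_mul η).integrable_of_hasCompactSupport
          (hgxc.norm.mul_left)) (Filter.Eventually.of_forall fun t => ?_)
        simp only [lsmul_apply, ← sub_smul, norm_smul, Real.norm_eq_abs]
        by_cases h : g (x - t) = 0
        · simp [h]
        · exact mul_le_mul_of_nonneg_right (hker t (hT (mem_support.2 h))) (norm_nonneg _)
    _ = η * ∫ t, ‖g (x - t)‖ ∂μ := integral_const_mul _ _
    _ = η * ∫ t, ‖g t‖ ∂μ := by rw [integral_sub_left_eq_self (fun t => ‖g t‖) μ x]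

/-- **Lemma 15.1 with a perturbed kernel, order `0`.** For `f` continuous with compact support,
`K` compact and `ε > 0` there are `R`, `η > 0`, `δ > 0` such that for every normed bump `ψ` of
outer radius `≤ δ` and every continuous kernel `k` that is `η`-close to `ψ` on the closed ball of
radius `R`, `‖(k ⋆ f)(x) - f(x)‖ ≤ ε` for all `x ∈ K` (Trèves 1967, Lemma 15.1, p. 144, with the
Gauss kernel replaced by any kernel close to an approximate identity). [folklore] -/
theorem exists_forall_norm_convolution_sub_self_le {F' : Type*} [NormedAddCommGroup F']
    [NormedSpace ℝ F'] [CompleteSpace F'] {f : E → F'} (hf : Continuous f)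
    (hfc : HasCompactSupport f) {K : Set E} (hK : IsCompact K) {ε : ℝ} (hε : 0 < ε) :
    ∃ R η δ : ℝ, 0 < η ∧ 0 < δ ∧ ∀ φ : ContDiffBump (0 : E), φ.rOut ≤ δ →
      ∀ k : E → ℝ, Continuous k → (∀ t ∈ closedBall (0 : E) R, |k t - φ.normed μ t| ≤ η) →
        ∀ x ∈ K, ‖(k ⋆[lsmul ℝ ℝ, μ] f) x - f x‖ ≤ ε := by
  obtain ⟨δ, hδ, hδf⟩ := Metric.uniformContinuous_iff.1
    (hfc.uniformContinuous_of_continuous hf) (ε / 2) (half_pos hε)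
  obtain ⟨R₁, hR₁⟩ := hK.isBounded.subset_closedBall (0 : E)
  obtain ⟨R₂, hR₂⟩ := hfc.isCompact.isBounded.subset_closedBall (0 : E)
  set Cf : ℝ := ∫ t, ‖f t‖ ∂μ with hCf_def
  have hCf0 : 0 ≤ Cf := integral_nonneg fun t => norm_nonneg _
  refine ⟨|R₁| + |R₂|, ε / (2 * (Cf + 1)), δ, by positivity, hδ, fun φ hφ k hk hker x hx => ?_⟩
  have hψcont : Continuous (φ.normed μ) := φ.continuous_normed
  have hFf : dist ((φ.normed μ ⋆[lsmul ℝ ℝ, μ] f) x) (f x) ≤ ε / 2 :=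
    φ.dist_normed_convolution_le hf.aestronglyMeasurable fun y hy =>
      (hδf (lt_of_lt_of_le (mem_ball.1 hy) hφ)).le
  have hmemD : ∀ t, x - t ∈ tsupport f → t ∈ closedBall (0 : E) (|R₁| + |R₂|) := by
    intro t ht
    have hx' : ‖x‖ ≤ |R₁| := (mem_closedBall_zero_iff.1 (hR₁ hx)).trans (le_abs_self _)
    have ht' : ‖x - t‖ ≤ |R₂| := (mem_closedBall_zero_iff.1 (hR₂ ht)).trans (le_abs_self _)
    rw [mem_closedBall_zero_iff]
    calc ‖t‖ = ‖x - (x - t)‖ := by rw [sub_sub_cancel]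
      _ ≤ ‖x‖ + ‖x - t‖ := norm_sub_le _ _
      _ ≤ |R₁| + |R₂| := add_le_add hx' ht'
  have hPF : dist ((k ⋆[lsmul ℝ ℝ, μ] f) x) ((φ.normed μ ⋆[lsmul ℝ ℝ, μ] f) x) ≤
      ε / (2 * (Cf + 1)) * Cf :=
    dist_convolution_le_of_abs_sub_kernel_le hk hψcont hf hfc subset_closure
      fun t ht => hker t (hmemD t ht)
  have hη : ε / (2 * (Cf + 1)) * Cf ≤ ε / 2 := by
    have hCf1 : 0 < Cf + 1 := by positivity
    have h1 : ε / (2 * (Cf + 1)) * Cf ≤ ε / (2 * (Cf + 1)) * (Cf + 1) :=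
      mul_le_mul_of_nonneg_left (by linarith) (by positivity)
    have h2 : ε / (2 * (Cf + 1)) * (Cf + 1) = ε / 2 := by
      field_simp
    linarith
  calc ‖(k ⋆[lsmul ℝ ℝ, μ] f) x - f x‖
      = dist ((k ⋆[lsmul ℝ ℝ, μ] f) x) (f x) := (dist_eq_norm _ _).symm
    _ ≤ dist ((k ⋆[lsmul ℝ ℝ, μ] f) x) ((φ.normed μ ⋆[lsmul ℝ ℝ, μ] f) x) +
          dist ((φ.normed μ ⋆[lsmul ℝ ℝ, μ] f) x) (f x) := dist_triangle _ _ _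
    _ ≤ ε / 2 + ε / 2 := add_le_add (hPF.trans hη) hFf
    _ = ε := add_halves ε

/-- **Corollary 1 of Lemma 15.1, with a perturbed kernel** (Trèves 1967, p. 145): the same as
`exists_forall_norm_convolution_sub_self_le` for all derivatives of order `≤ m` of a compactly
supported `𝒞^m` function — by induction on `m`, moving one derivative onto `f`
(`fderiv_convolution_sub_self`, Leibniz' rule) and applying the induction hypothesis to `Df`
("it suffices then to apply Lemma 15.1 with `(∂/∂x)^p f` instead of `f`"). [folklore] -/
theorem exists_forall_norm_iteratedFDeriv_convolution_sub_self_le {K : Set E} (hK : IsCompact K)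
    (m : ℕ) :
    ∀ {F' : Type max u v} [NormedAddCommGroup F'] [NormedSpace ℝ F'] [CompleteSpace F']
      {f : E → F'}, ContDiff ℝ m f → HasCompactSupport f → ∀ {ε : ℝ}, 0 < ε →
      ∃ R η δ : ℝ, 0 < η ∧ 0 < δ ∧ ∀ φ : ContDiffBump (0 : E), φ.rOut ≤ δ →
        ∀ k : E → ℝ, Continuous k → (∀ t ∈ closedBall (0 : E) R, |k t - φ.normed μ t| ≤ η) →
          ∀ i ≤ m, ∀ x ∈ K, ‖iteratedFDeriv ℝ i (k ⋆[lsmul ℝ ℝ, μ] f - f) x‖ ≤ ε := by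
  induction m with
  | zero =>
    intro F' _ _ _ f hf hfc ε hε
    obtain ⟨R, η, δ, hη, hδ, h⟩ :=
      exists_forall_norm_convolution_sub_self_le (μ := μ) hf.continuous hfc hK hε
    refine ⟨R, η, δ, hη, hδ, fun φ hφ k hk hker i hi x hx => ?_⟩
    obtain rfl : i = 0 := Nat.le_zero.1 hi
    rw [norm_iteratedFDeriv_zero]
    exact h φ hφ k hk hker x hx
  | succ m ih =>
    intro F' _ _ _ f hf hfc ε hε
    have hf1 : ContDiff ℝ 1 f := hf.of_le (by exact_mod_cast Nat.le_add_left 1 m)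
    have hf' : ContDiff ℝ ((m : ℕ∞ω) + 1) f := by exact_mod_cast hf
    have hDf : ContDiff ℝ m (fderiv ℝ f) := (contDiff_succ_iff_fderiv.1 hf').2.2
    have hDfc : HasCompactSupport (fderiv ℝ f) := hfc.fderiv ℝ
    obtain ⟨R₀, η₀, δ₀, hη₀, hδ₀, h₀⟩ :=
      exists_forall_norm_convolution_sub_self_le (μ := μ) hf.continuous hfc hK hε
    obtain ⟨R₁, η₁, δ₁, hη₁, hδ₁, h₁⟩ := ih hDf hDfc hε
    refine ⟨max R₀ R₁, min η₀ η₁, min δ₀ δ₁, lt_min hη₀ hη₁, lt_min hδ₀ hδ₁,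
      fun φ hφ k hk hker i hi x hx => ?_⟩
    have hker₀ : ∀ t ∈ closedBall (0 : E) R₀, |k t - φ.normed μ t| ≤ η₀ := fun t ht =>
      (hker t (closedBall_subset_closedBall (le_max_left _ _) ht)).trans (min_le_left _ _)
    have hker₁ : ∀ t ∈ closedBall (0 : E) R₁, |k t - φ.normed μ t| ≤ η₁ := fun t ht =>
      (hker t (closedBall_subset_closedBall (le_max_right _ _) ht)).trans (min_le_right _ _)
    rcases i with _ | j
    · rw [norm_iteratedFDeriv_zero]
      exact h₀ φ (hφ.trans (min_le_left _ _)) k hk hker₀ x hx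
    · rw [← norm_iteratedFDeriv_fderiv, fderiv_convolution_sub_self hk hf1 hfc]
      exact h₁ φ (hφ.trans (min_le_right _ _)) k hk hker₁ j (by omega) x hx

/-- **Approximation with derivatives by kernels from a `𝒞⁰`-dense family** (the abstract form of
Trèves 1967, Ch. 15, Cor. 2 of Lemma 15.1): if `𝒦` is a family of continuous kernels on `E` that
approximates every continuous function uniformly on every ball, then for a compactly supported
`𝒞^m` function `f`, a compact `K` and `ε > 0` some `k ∈ 𝒦` has `‖Dⁱ(k ⋆ f - f)(x)‖ ≤ ε` for all
`i ≤ m`, `x ∈ K`. [folklore] -/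
theorem exists_mem_forall_norm_iteratedFDeriv_convolution_sub_self_le (𝒦 : Set (E → ℝ))
    (h𝒦c : ∀ k ∈ 𝒦, Continuous k)
    (h𝒦d : ∀ (R : ℝ) (ψ : E → ℝ), Continuous ψ → ∀ η : ℝ, 0 < η →
      ∃ k ∈ 𝒦, ∀ t ∈ closedBall (0 : E) R, |k t - ψ t| ≤ η)
    {F' : Type max u v} [NormedAddCommGroup F'] [NormedSpace ℝ F'] [CompleteSpace F']
    {f : E → F'} {m : ℕ} (hf : ContDiff ℝ m f) (hfc : HasCompactSupport f)
    {K : Set E} (hK : IsCompact K) {ε : ℝ} (hε : 0 < ε) :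
    ∃ k ∈ 𝒦, ∀ i ≤ m, ∀ x ∈ K, ‖iteratedFDeriv ℝ i (k ⋆[lsmul ℝ ℝ, μ] f - f) x‖ ≤ ε := by
  obtain ⟨R, η, δ, hη, hδ, h⟩ :=
    exists_forall_norm_iteratedFDeriv_convolution_sub_self_le (μ := μ) hK m hf hfc hε
  let φ : ContDiffBump (0 : E) := ⟨δ / 2, δ, half_pos hδ, half_lt_self hδ⟩
  obtain ⟨k, hk, hkψ⟩ := h𝒦d R (φ.normed μ) φ.continuous_normed η hη
  exact ⟨k, hk, h φ le_rfl k (h𝒦c k hk) hkψ⟩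

omit [MeasurableSpace E] [BorelSpace E] in
/-- **Smooth cutoff** (Trèves 1967, proof of Thm. 15.3, p. 148: `h_j f ∈ 𝒞^k`, `h_j f = f` on
`Ω_{j-1}`): a function of class `𝒞^k` on an open set `Ω ⊇ K`, `K` compact, agrees near `K` with
a compactly supported function of class `𝒞^k` on the whole space. [folklore] -/
theorem exists_contDiff_hasCompactSupport_eventuallyEq {F' : Type*} [NormedAddCommGroup F']
    [NormedSpace ℝ F'] {f : E → F'} {k : ℕ} {Ω K : Set E} (hΩ : IsOpen Ω)
    (hf : ContDiffOn ℝ k f Ω) (hK : IsCompact K) (hKΩ : K ⊆ Ω) :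
    ∃ g : E → F', ContDiff ℝ k g ∧ HasCompactSupport g ∧ ∀ x ∈ K, g =ᶠ[𝓝 x] f := by
  obtain ⟨V, hVo, hKV, hVΩ, hVc⟩ := exists_open_between_and_isCompact_closure hK hΩ hKΩ
  obtain ⟨W, hWo, hKW, hWV, -⟩ := exists_open_between_and_isCompact_closure hK hVo hKV
  have hd : Disjoint Vᶜ (closure W) := disjoint_compl_left_iff.2 hWV
  obtain ⟨χ, hχ0, hχ1, -⟩ := exists_contMDiffMap_zero_one_of_isClosed (I := 𝓘(ℝ, E)) (M := E)
    (n := (⊤ : ℕ∞)) hVo.isClosed_compl isClosed_closure hd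
  have hχ : ContDiff ℝ k χ := χ.contMDiff.contDiff.of_le (by exact_mod_cast le_top)
  refine ⟨fun x => χ x • f x, ?_, ?_, ?_⟩
  · rw [contDiff_iff_contDiffAt]
    intro x
    by_cases hx : x ∈ Ω
    · exact hχ.contDiffAt.smul (hf.contDiffAt (hΩ.mem_nhds hx))
    · have hxV : x ∉ closure V := fun h => hx (hVΩ h)
      have h0 : (fun y => χ y • f y) =ᶠ[𝓝 x] fun _ => 0 := by
        filter_upwards [isClosed_closure.isOpen_compl.mem_nhds hxV] with y hy
        have hy' : χ y = 0 := hχ0 fun hyV => hy (subset_closure hyV)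
        simp [hy']
      exact contDiffAt_const.congr_of_eventuallyEq h0
  · refine HasCompactSupport.of_support_subset_isCompact hVc fun y hy => subset_closure ?_
    by_contra hyV
    exact hy (by simp [hχ0 hyV])
  · intro x hx
    filter_upwards [hWo.mem_nhds (hKW hx)] with y hy
    simp [hχ1 (subset_closure hy)]

end Engine

section Pi

variable {n : ℕ}

/-- **Weierstrass approximation on compact subsets of `ℝⁿ = Fin n → ℝ`** (`𝒞⁰`):
Stone–Weierstrass (`ContinuousMap.exists_mem_subalgebra_near_continuous_of_isCompact_of_
separatesPoints`) for the range of `MvPolynomial.aeval (coordinate functions)`, which separates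
points. [folklore] -/
theorem exists_mvPolynomial_abs_eval_sub_lt {K : Set (Fin n → ℝ)} (hK : IsCompact K)
    {f : (Fin n → ℝ) → ℝ} (hf : Continuous f) {ε : ℝ} (hε : 0 < ε) :
    ∃ p : MvPolynomial (Fin n) ℝ, ∀ x ∈ K, |MvPolynomial.eval x p - f x| < ε := by
  classical
  let c : Fin n → C((Fin n → ℝ), ℝ) := fun i => ⟨fun x => x i, continuous_apply i⟩
  let A : Subalgebra ℝ C((Fin n → ℝ), ℝ) := (MvPolynomial.aeval c).range
  have hA : A.SeparatesPoints := by
    intro x y hxy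
    obtain ⟨i, hi⟩ : ∃ i, x i ≠ y i := by
      by_contra h
      push Not at h
      exact hxy (funext h)
    exact ⟨c i, ⟨c i, (AlgHom.mem_range _).2 ⟨MvPolynomial.X i, MvPolynomial.aeval_X c i⟩,
      rfl⟩, hi⟩
  obtain ⟨g, hgA, hg⟩ :=
    ContinuousMap.exists_mem_subalgebra_near_continuous_of_isCompact_of_separatesPoints hA
      ⟨f, hf⟩ hK hε
  obtain ⟨p, rfl⟩ := (AlgHom.mem_range _).1 hgA
  refine ⟨p, fun x hx => ?_⟩
  have heval : (MvPolynomial.aeval c p : C((Fin n → ℝ), ℝ)) x = MvPolynomial.eval x p := by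
    change ContinuousMap.evalAlgHom ℝ ℝ x (MvPolynomial.aeval c p) = _
    rw [MvPolynomial.comp_aeval_apply]
    rfl
  have := hg x hx
  rwa [heval, Real.norm_eq_abs] at this

/-- **The convolution of a polynomial kernel with a compactly supported continuous function on
`Fin n → ℝ` is a polynomial function**: `(k ⋆ f)(x) = ∫ k(x - s) f(s) ds = ∑ₘ (∫ f c_m) xᵐ`
(`Literature.Topology.FourManifolds.exists_eval_sub_eq_sum`). [folklore] -/
theorem exists_mvPolynomial_convolution_eval_eq (k : MvPolynomial (Fin n) ℝ)
    {f : (Fin n → ℝ) → ℝ} (hf : Continuous f) (hfc : HasCompactSupport f) :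
    ∃ p : MvPolynomial (Fin n) ℝ, ∀ x : Fin n → ℝ,
      ((fun t => MvPolynomial.eval t k) ⋆[lsmul ℝ ℝ, volume] f) x = MvPolynomial.eval x p := by
  classical
  obtain ⟨S, c, hS⟩ := Literature.Topology.FourManifolds.exists_eval_sub_eq_sum k
  refine ⟨∑ m ∈ S, MvPolynomial.C (∫ s, f s * MvPolynomial.eval s (c m)) *
    ∏ i, MvPolynomial.X i ^ m i, fun x => ?_⟩
  have h1 : ((fun t => MvPolynomial.eval t k) ⋆[lsmul ℝ ℝ, volume] f) x =
      ∫ s, f s * MvPolynomial.eval (x - s) k := by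
    rw [convolution_def, ← integral_sub_left_eq_self
      (fun s => f s * MvPolynomial.eval (x - s) k) volume x]
    refine integral_congr_ae (Filter.Eventually.of_forall fun t => ?_)
    simp only [lsmul_apply, smul_eq_mul, sub_sub_cancel, mul_comm]
  rw [h1]
  simp_rw [hS, Finset.mul_sum]
  rw [integral_finsetSum]
  · simp only [map_sum, map_mul, MvPolynomial.eval_C, map_prod, map_pow, MvPolynomial.eval_X]
    refine Finset.sum_congr rfl fun m _ => ?_
    rw [← integral_mul_const]
    refine integral_congr_ae (Filter.Eventually.of_forall fun s => ?_)
    simp only [mul_assoc]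
  · intro m _
    have hc : Continuous fun s : Fin n → ℝ =>
        f s * (MvPolynomial.eval s (c m) * ∏ i, x i ^ m i) :=
      hf.mul ((MvPolynomial.continuous_eval (c m)).mul continuous_const)
    exact hc.integrable_of_hasCompactSupport hfc.mul_right

/-- **Corollary 2 of Lemma 15.1 on `ℝⁿ = Fin n → ℝ`** (Trèves 1967, p. 145: "every function
`f ∈ 𝒞_c^m(ℝⁿ)` is the limit, in `𝒞^m(ℝⁿ)`, of a sequence of polynomials"), `ε`–`K` form: for a
compactly supported `𝒞^m` function `f`, a compact `K` and `ε > 0` some real polynomial `P` has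
`‖Dⁱ(P - f)(x)‖ ≤ ε` for all `i ≤ m`, `x ∈ K`. Proof: Trèves' regularisation argument (Lemma 15.1
and its Cor. 1) with the Gauss kernel replaced by a polynomial kernel uniformly close, on the
relevant ball, to a smooth approximate identity (Weierstrass 1885 / Stone–Weierstrass), so that the
regularisation is itself a polynomial. [cite: Treves1967, Ch. 15, Cor. 2 of Lemma 15.1, p. 145] -/
theorem exists_mvPolynomial_forall_norm_iteratedFDeriv_sub_le {f : (Fin n → ℝ) → ℝ} {m : ℕ}
    (hf : ContDiff ℝ m f) (hfc : HasCompactSupport f) {K : Set (Fin n → ℝ)} (hK : IsCompact K)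
    {ε : ℝ} (hε : 0 < ε) :
    ∃ P : MvPolynomial (Fin n) ℝ, ∀ i ≤ m, ∀ x ∈ K,
      ‖iteratedFDeriv ℝ i (fun y => MvPolynomial.eval y P - f y) x‖ ≤ ε := by
  obtain ⟨k, ⟨q, rfl⟩, hk⟩ := exists_mem_forall_norm_iteratedFDeriv_convolution_sub_self_le
    (μ := (volume : Measure (Fin n → ℝ)))
    (Set.range fun q : MvPolynomial (Fin n) ℝ => fun t => MvPolynomial.eval t q)
    (by rintro _ ⟨q, rfl⟩; exact MvPolynomial.continuous_eval q)
    (fun R ψ hψ η hη => by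
      obtain ⟨q, hq⟩ := exists_mvPolynomial_abs_eval_sub_lt (isCompact_closedBall 0 R) hψ hη
      exact ⟨_, ⟨q, rfl⟩, fun t ht => (hq t ht).le⟩)
    hf hfc hK hε
  obtain ⟨P, hP⟩ := exists_mvPolynomial_convolution_eval_eq q hf.continuous hfc
  refine ⟨P, fun i hi x hx => ?_⟩
  have hfun : (fun y => MvPolynomial.eval y P - f y) =
      ((fun t => MvPolynomial.eval t q) ⋆[lsmul ℝ ℝ, volume] f - f) := by
    funext y
    simp [hP y]
  rw [hfun]
  exact hk i hi x hx

/-- **Trèves 1967, Ch. 15, Corollary 4 of Theorem 15.3, discharged**: polynomials are dense in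
`𝒞^k(Ω)` (finite `k`, seminorm form). Proof as printed ("combine Corollary 1 of Theorem 15.3 with
Corollary 2 of Lemma 15.1"): cut `f` off to a compactly supported `𝒞^k` function equal to `f` near
`K` (`exists_contDiff_hasCompactSupport_eventuallyEq`), then apply the compactly supported case
`exists_mvPolynomial_forall_norm_iteratedFDeriv_sub_le`; the derivatives of order `≤ k` at points
of `K` only see `f` near `K`. [cite: Treves1967, Ch. 15, Cor. 4 of Thm. 15.3, p. 149] -/
theorem Treves1967_ch15_cor4_holds : Treves1967_ch15_cor4 := by
  intro n k Ω hΩ f hf K hK hKΩ ε hε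
  obtain ⟨g, hg, hgc, hgf⟩ := exists_contDiff_hasCompactSupport_eventuallyEq hΩ hf hK hKΩ
  obtain ⟨P, hP⟩ := exists_mvPolynomial_forall_norm_iteratedFDeriv_sub_le hg hgc hK hε
  refine ⟨P, fun i hi x hx => ?_⟩
  have h : (fun y => MvPolynomial.eval y P - f y) =ᶠ[𝓝 x]
      fun y => MvPolynomial.eval y P - g y := by
    filter_upwards [hgf x hx] with y hy
    rw [hy]
  rw [(h.iteratedFDeriv ℝ i).self_of_nhds]
  exact hP i hi x hx

end Pi

end Literature.Analysis.Approximation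

end
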